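import Summits.QuantumFields.YangMills.Theorems.IR.Negative.TypShellCondUKPcFalseOfWildWire

/-!
# Crux `IR` (stmt-QuantumFields-19354), slot of record `af-pincer-Uc` (skeleton sha16 b6e69d9662b5b07a):
# WEAK MIXING AT ONE SCALE, FREQUENTLY IN `β`, KILLS BOTH WIRES — `WildWire`/`MassWire` = «no boundary-uniform
# exponential mixing at ANY scale for all large `β`» (disprove-1 g6, Negative lane; owner reading R77 §5(ii))

The two typed kill-hypotheses of this lane — `OnsetFormatsUc.WildWire ρ` (p514971: refutes `stub_onsetUc`'s
statement `OnsetMixingTypicalUKPc`, format Uc) and `OnsetFormats.MassWire ρ` (p500647: refutes the T-format stub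
statement `OnsetMixingTypical`) — assert boundary-condition POLARISATION (`≤ 1/3` vs `≥ 2/3`) of a centre-cell
observable through a resampled region, at EVERY mesh `b ≥ 1` and EVERY window parameter `n ≥ 1`, for all large `β`.
This file makes the owner's reading R77 («WildWire(SU2) describes a world with NO boundary-uniform exponential
clustering at ANY scale for all large β») a tree edge:

* §1 `WeakMixing ρ β C ℓ` — Martinelli's WEAK MIXING condition WM(V, C, m) [Martinelli, *Lectures on Glauber
  dynamics for discrete spin models*, in LNM 1717 (Saint-Flour 1997), Def. 2.3, p. 100] for the Wilson DLR kernels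
  `γ_Λ(· | ζ) = ymSpecification ρ β Λ ζ` of four-dimensional lattice gauge theory: for EVERY finite edge set `Λ`,
  every `Δ ⊆ Λ` whose base points are at sup-distance `≥ R` from every edge outside `Λ`, every `[0,1]`-valued
  measurable `Δ`-cylinder `f` and EVERY two exterior data `ζ, ζ'`:
  `|∫ f dγ_Λ(ζ) − ∫ f dγ_Λ(ζ')| ≤ C · #Δ · e^{−R/ℓ}` (boundary influence dies in the bulk at rate `1/ℓ`, uniformly
  in the boundary condition).  `HasWeakMixing ρ β := ∃ C ℓ, 0 < ℓ ∧ WeakMixing ρ β C ℓ`.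
* §2 frame geometry: the centre cell of a mesh-`b` frame has `≤ 64 b⁴` edges (`IsFrame.card_cellEdges_zero_le`) and
  lies at sup-distance `≥ m·b + 1` from every edge outside a region containing the cells of index-radius `m`
  (`IsFrame.dist_cellEdges_zero`).
* §3 `not_wildWireAt_of_weakMixing` / `not_massWireAt_of_weakMixing`: `WeakMixing ρ β C ℓ` with
  `64 C b⁴ e^{−((2n+2)b+1)/ℓ} < 1/3`, resp. `64 C b⁴ e^{−(2nb+1)/ℓ} < 1/3`, forbids the wire at `(β, b, n)` — the
  quantitative form of R77 §2 («no designed collar polarises once `b ≫ ξ log(b³ …)`»).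
* §4 `not_wildWire_of_frequently_hasWeakMixing : (∃ᶠ β in atTop, HasWeakMixing ρ β) → ¬ WildWire ρ`, the
  `∀ᶠ` corollary (the owner's shape R77 §5(ii)), the contrapositive `wildWire_eventually_not_hasWeakMixing :
  WildWire ρ → ∀ᶠ β in atTop, ¬ HasWeakMixing ρ β`, and the same three for `MassWire`.  Proof: at a weakly mixing
  `β ≥ β₀` take mesh `b = 1` and a window `n` with `2n + 3 > 192 C ℓ`.

Reading.  The kill hypotheses of p514971 / p500647 hold only in a world where, beyond some `β₀`, weak mixing fails
at EVERY `β` (no finite scale of boundary-uniform exponential decorrelation: gapless, or boundary phases at every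
scale) — the world `stub_onsetUc` bets against; in the intended massive world (`ℓ(β) ~ ξ(β) < ∞`) both wires are
false and the verdict of record stays NOT REFUTED (memo `pub/ym-beyond/ym-19354-disprove-1/NOT-REFUTED.md` §11).
Nothing here is a theorem about `IR`, the gap, or `SU(2)`.
Remarks.  (1) Martinelli's (2.6) bounds the variation distance of the `Δ`-marginals by
`C Σ_{x ∈ Δ} Σ_{y ∈ ∂⁺V} e^{−m d(x,y)}`; summing lattice shells (`#{y : d(x,y) = k} ≤ c k³`) gives
`Σ_{y ∉ V} e^{−m d(x,y)} ≤ K_m e^{−mR/2}` when `d(x, Vᶜ) ≥ R`, so WM(V, C, m) for all finite `V` implies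
`WeakMixing ρ β (C K_m) (2/m)` (informal, not used).  (2) Distance = sup-norm of base points (tree convention,
`setDistEdges` / `linkSetDist`); tests = `[0,1]`-valued measurable cylinders (total variation up to a factor `2`).
(3) WM is WEAKER than Martinelli's strong mixing SM (Def. 2.4) and than complete analyticity; format Uc of the slot
is the «all exterior data» format (owner R59-U) — uniformity in `ζ, ζ'` exactly as here.  (4) Chatterjee's
`HasStrongExpDecay` (`Literature/…/StrongExpDecayLGT`) is covariance decay inside a cube at FIXED boundary condition —
a different property, not used.  Sorry-free; axioms `propext`, `Classical.choice`, `Quot.sound`; `WeakMixing` /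
`HasWeakMixing` are hypothesis notions (`def … : Prop` with parameters), never asserted.  Imports are Theses-free.
-/

set_option autoImplicit false

noncomputable section

open Filter Topology MeasureTheory
open Literature.MathematicalPhysics.QuantumLattice
open Literature.Probability.LatticeModels
open Summit.QuantumFields.YangMills.Cruxes.IR.Tempered (cellEdges windowCells regionEdges)
open Summit.QuantumFields.YangMills.Cruxes.IR.CellTempered.Engine (frameCell mem_cellEdges_frameCell)
open Summit.QuantumFields.YangMills.Cruxes.IR.OnsetFormats (MassWireAt MassWire zero_mem_windowCells)

namespace Summit.QuantumFields.YangMills.Cruxes.IR.OnsetFormatsUc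

/-! ## §1 Weak mixing (Martinelli WM) for the Wilson DLR kernels -/

section WeakMixingDef

variable {G : Type} [Group G] [TopologicalSpace G] [IsTopologicalGroup G] [CompactSpace G]
  [MeasurableSpace G] [BorelSpace G]

/-- **Weak mixing with constants `(C, ℓ)`** for the Wilson DLR kernels of `(ρ, β)` on `ℤ⁴` (Martinelli, LNM 1717,
Def. 2.3 «WM(V, C, m)», for ALL finite `V`, in the lattice-summed form — see the module docstring): for every
finite edge set `Λ`, every `Δ ⊆ Λ` and every `R` such that each edge of `Δ` is at base-point sup-distance `≥ R`
from each edge outside `Λ`, every `[0,1]`-valued measurable `Δ`-cylinder `f` and every two exterior data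
`ζ, ζ'`: `|∫ f dγ_Λ(ζ) − ∫ f dγ_Λ(ζ')| ≤ C · #Δ · exp (−R/ℓ)`. -/
def WeakMixing {N : ℕ} (ρ : G →* Matrix (Fin N) (Fin N) ℂ) (β C ℓ : ℝ) : Prop :=
  ∀ (Λ Δ : Finset (ZdEdge 4)) (R : ℝ), Δ ⊆ Λ →
    (∀ e ∈ Δ, ∀ e' : ZdEdge 4, e' ∉ Λ → R ≤ ‖e.1 - e'.1‖) →
    ∀ f : LGConfig 4 G → ℝ, IsCylinder f Δ → Measurable f → (∀ U, 0 ≤ f U ∧ f U ≤ 1) →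
      ∀ ζ ζ' : LGConfig 4 G,
        |(∫ U, f U ∂(ymSpecification ρ β Λ ζ)) - ∫ U, f U ∂(ymSpecification ρ β Λ ζ')| ≤
          C * Δ.card * Real.exp (-R / ℓ)

/-- **Weak mixing at SOME scale**: `∃ C ℓ, 0 < ℓ ∧ WeakMixing ρ β C ℓ` — boundary influence on the Wilson
kernels of `(ρ, β)` decays exponentially into the bulk at some finite rate, uniformly in the boundary condition. -/
def HasWeakMixing {N : ℕ} (ρ : G →* Matrix (Fin N) (Fin N) ℂ) (β : ℝ) : Prop :=
  ∃ C ℓ : ℝ, 0 < ℓ ∧ WeakMixing ρ β C ℓ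

end WeakMixingDef

/-! ## §2 Frame geometry: size of the centre cell, distance from the centre cell to the exterior -/

section Geometry

variable {b : ℕ} {w : Fin 4 → ℤ → ℤ}

/-- Frame growth: `w i j + m·b ≤ w i (j + m)`. -/
theorem IsFrame.add_mul_le (hw : IsFrame b w) (i : Fin 4) (j : ℤ) (m : ℕ) :
    w i j + (m : ℤ) * (b : ℤ) ≤ w i (j + (m : ℤ)) := by
  induction m with
  | zero => simp
  | succ m ih =>
    have h := (hw i (j + (m : ℤ))).1
    have e1 : w i j + ((m + 1 : ℕ) : ℤ) * (b : ℤ) = (w i j + (m : ℤ) * (b : ℤ)) + (b : ℤ) := by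
      push_cast; ring
    have e2 : j + ((m + 1 : ℕ) : ℤ) = j + (m : ℤ) + 1 := by push_cast; ring
    rw [e1, e2]
    linarith

/-- Frames are monotone. -/
theorem IsFrame.mono (hw : IsFrame b w) (i : Fin 4) {j j' : ℤ} (h : j ≤ j') : w i j ≤ w i j' := by
  obtain ⟨m, rfl⟩ := Int.le.dest h
  have h1 := hw.add_mul_le i j m
  have h2 : (0 : ℤ) ≤ (m : ℤ) * (b : ℤ) := by positivity
  linarith

/-- Membership in a frame cell, coordinatewise. -/
theorem mem_cellEdges_iff (w : Fin 4 → ℤ → ℤ) (y : Fin 4 → ℤ) (e : ZdEdge 4) :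
    e ∈ cellEdges w y ↔ ∀ i, w i (y i) ≤ e.1 i ∧ e.1 i < w i (y i + 1) := by
  simp only [Summit.QuantumFields.YangMills.Cruxes.IR.Tempered.cellEdges, Finset.mem_product,
    Fintype.mem_piFinset, Finset.mem_Ico, Finset.mem_univ, and_true]

/-- **The centre cell of a mesh-`b` frame has at most `64 b⁴` edges** (widths `≤ 2b`, four directions). -/
theorem IsFrame.card_cellEdges_zero_le (hw : IsFrame b w) : (cellEdges w 0).card ≤ 64 * b ^ 4 := by
  have hwid : ∀ i ∈ (Finset.univ : Finset (Fin 4)),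
      (Finset.Ico (w i ((0 : Fin 4 → ℤ) i)) (w i ((0 : Fin 4 → ℤ) i + 1))).card ≤ 2 * b := by
    intro i _
    rw [Int.card_Ico, Pi.zero_apply, zero_add]
    have h := (hw i 0).2
    rw [zero_add] at h
    omega
  rw [Summit.QuantumFields.YangMills.Cruxes.IR.Tempered.cellEdges, Finset.card_product, Fintype.card_piFinset,
    Finset.card_univ, Fintype.card_fin]
  calc (∏ i : Fin 4, (Finset.Ico (w i ((0 : Fin 4 → ℤ) i)) (w i ((0 : Fin 4 → ℤ) i + 1))).card) * 4
      ≤ (∏ _i : Fin 4, 2 * b) * 4 :=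
        Nat.mul_le_mul_right 4 (Finset.prod_le_prod (fun i _ => Nat.zero_le _) hwid)
    _ = 64 * b ^ 4 := by
        rw [Finset.prod_const, Finset.card_univ, Fintype.card_fin]
        ring

/-- The centre cell of a mesh-`b ≥ 1` frame is non-empty. -/
theorem IsFrame.one_le_card_cellEdges_zero (hw : IsFrame b w) (hb : 1 ≤ b) : 1 ≤ (cellEdges w 0).card := by
  refine Finset.card_pos.2 ⟨((fun i => w i 0), 0), (mem_cellEdges_iff w 0 _).2 fun i => ?_⟩
  have hb1 : (1 : ℤ) ≤ (b : ℤ) := by exact_mod_cast hb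
  have hwi := (hw i 0).1
  simp only [Pi.zero_apply, zero_add] at hwi ⊢
  constructor <;> linarith

/-- **Distance from the centre cell to the exterior of a region containing the index-radius-`m` cells**: if
`1 ≤ b`, every cell `c` with `|c i| ≤ m` for all `i` lies in `Y`, `e` is a centre-cell edge and `e'` is an edge
outside `regionEdges w Y`, then `m·b + 1 ≤ ‖e.1 − e'.1‖` (sup-norm of base points). -/
theorem IsFrame.dist_cellEdges_zero (hw : IsFrame b w) (hb : 1 ≤ b) {m : ℕ} {Y : Finset (Fin 4 → ℤ)}
    (hY : ∀ c : Fin 4 → ℤ, (∀ i, -(m : ℤ) ≤ c i ∧ c i ≤ (m : ℤ)) → c ∈ Y)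
    {e e' : ZdEdge 4} (he : e ∈ cellEdges w 0) (he' : e' ∉ regionEdges w Y) :
    (m : ℝ) * (b : ℝ) + 1 ≤ ‖e.1 - e'.1‖ := by
  have hb1 : (1 : ℤ) ≤ (b : ℤ) := by exact_mod_cast hb
  have hw1 : ∀ i j, w i j + 1 ≤ w i (j + 1) := fun i j => by linarith [(hw i j).1]
  -- the cell of `e'` is not in `Y`
  set c' : Fin 4 → ℤ := frameCell w e' with hc'
  have he'c : e' ∈ cellEdges w c' := mem_cellEdges_frameCell hw1 e'
  have hc'Y : c' ∉ Y := fun h => he' (Finset.mem_biUnion.mpr ⟨c', h, he'c⟩)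
  -- hence one index coordinate is beyond radius `m`
  obtain ⟨i, hi⟩ : ∃ i, (m : ℤ) + 1 ≤ c' i ∨ c' i + 1 ≤ -(m : ℤ) := by
    by_contra hno
    push Not at hno
    exact hc'Y (hY c' fun i => by obtain ⟨h1, h2⟩ := hno i; constructor <;> omega)
  -- coordinates of the two base points in direction `i`
  have hei : w i 0 ≤ e.1 i ∧ e.1 i < w i 1 := by
    have h := (mem_cellEdges_iff w 0 e).1 he i
    simpa only [Pi.zero_apply, zero_add] using h
  have he'i : w i (c' i) ≤ e'.1 i ∧ e'.1 i < w i (c' i + 1) := (mem_cellEdges_iff w c' e').1 he'c i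
  -- the coordinate gap is `≥ m·b + 1`
  have hmb : (0 : ℤ) ≤ (m : ℤ) * (b : ℤ) := by positivity
  have hgap : (m : ℤ) * (b : ℤ) + 1 ≤ |e.1 i - e'.1 i| := by
    rcases hi with hi | hi
    · have h1 : w i 1 + (m : ℤ) * (b : ℤ) ≤ w i (1 + (m : ℤ)) := hw.add_mul_le i 1 m
      have h2 : w i (1 + (m : ℤ)) ≤ w i (c' i) := hw.mono i (by omega)
      rw [abs_sub_comm, abs_of_nonneg (by linarith [hei.2, he'i.1])]
      linarith [hei.2, he'i.1]
    · have h1 : w i (-(m : ℤ)) + (m : ℤ) * (b : ℤ) ≤ w i (-(m : ℤ) + (m : ℤ)) := hw.add_mul_le i (-(m : ℤ)) m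
      rw [neg_add_cancel] at h1
      have h2 : w i (c' i + 1) ≤ w i (-(m : ℤ)) := hw.mono i hi
      rw [abs_of_nonneg (by linarith [hei.1, he'i.2])]
      linarith [hei.1, he'i.2]
  -- pass to `ℝ` and to the sup norm
  have hnorm : ‖(e.1 - e'.1) i‖ ≤ ‖e.1 - e'.1‖ := norm_le_pi_norm (e.1 - e'.1) i
  rw [Pi.sub_apply, Int.norm_eq_abs] at hnorm
  have hcast : (m : ℝ) * (b : ℝ) + 1 ≤ |((e.1 i - e'.1 i : ℤ) : ℝ)| := by
    rw [← Int.cast_abs]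
    exact_mod_cast hgap
  exact hcast.trans hnorm

/-- Index-radius-`(2n+2)` cells lie in any `F' ⊇ collarBlock n`. -/
theorem mem_of_collarBlock_subset {n : ℕ} {F' : Finset (Fin 4 → ℤ)} (hF' : collarBlock n ⊆ F')
    (c : Fin 4 → ℤ) (hc : ∀ i, -((2 * n + 2 : ℕ) : ℤ) ≤ c i ∧ c i ≤ ((2 * n + 2 : ℕ) : ℤ)) : c ∈ F' := by
  apply hF'
  rw [collarBlock, Fintype.mem_piFinset]
  intro i
  rw [Finset.mem_Icc]
  obtain ⟨h1, h2⟩ := hc i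
  push_cast at h1 h2
  constructor <;> linarith

/-- Index-radius-`2n` cells lie in the window. -/
theorem mem_windowCells_of_abs_le {n : ℕ} (c : Fin 4 → ℤ)
    (hc : ∀ i, -((2 * n : ℕ) : ℤ) ≤ c i ∧ c i ≤ ((2 * n : ℕ) : ℤ)) : c ∈ windowCells n := by
  rw [Summit.QuantumFields.YangMills.Cruxes.IR.Tempered.windowCells, Fintype.mem_piFinset]
  intro i
  rw [Finset.mem_Icc]
  obtain ⟨h1, h2⟩ := hc i
  push_cast at h1 h2
  constructor <;> linarith

/-- The centre cell lies in the region of any cell set containing `0`. -/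
theorem cellEdges_zero_subset_regionEdges {Y : Finset (Fin 4 → ℤ)} (h0 : (0 : Fin 4 → ℤ) ∈ Y) :
    cellEdges w 0 ⊆ regionEdges w Y := by
  rw [Summit.QuantumFields.YangMills.Cruxes.IR.Tempered.regionEdges]
  exact Finset.subset_biUnion_of_mem (cellEdges w) h0

end Geometry

/-! ## §3 Weak mixing at `(β, C, ℓ)` forbids both wires at every mesh/window with `64 C b⁴ e^{−R/ℓ} < 1/3` -/

section Kill

variable {G : Type} [Group G] [TopologicalSpace G] [IsTopologicalGroup G] [CompactSpace G]
  [MeasurableSpace G] [BorelSpace G]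

/-- From a weak-mixing bound at a non-empty `Δ`: the bound with `#Δ` replaced by any larger number. -/
theorem weakMixing_bound_mono {C E x : ℝ} {k K : ℕ} (hk : 1 ≤ k) (hkK : k ≤ K)
    (hx : x ≤ C * (k : ℝ) * E) (h0 : 0 ≤ x) : x ≤ C * (K : ℝ) * E := by
  have hk0 : (0 : ℝ) < (k : ℝ) := by exact_mod_cast hk
  have hCE : 0 ≤ C * E := by
    have h1 : 0 ≤ C * E * (k : ℝ) := by rw [mul_right_comm]; exact h0.trans hx
    exact (mul_nonneg_iff_of_pos_right hk0).1 h1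
  have hkK' : (k : ℝ) ≤ (K : ℝ) := by exact_mod_cast hkK
  calc x ≤ C * (k : ℝ) * E := hx
    _ = C * E * (k : ℝ) := mul_right_comm _ _ _
    _ ≤ C * E * (K : ℝ) := mul_le_mul_of_nonneg_left hkK' hCE
    _ = C * (K : ℝ) * E := mul_right_comm _ _ _

/-- **Weak mixing forbids the wild wire at `(β, b, n)`** whenever `64 C b⁴ · exp (−((2n+2)b+1)/ℓ) < 1/3`:
the two wild data would polarise a centre-cell event by `≥ 1/3` through `γ_{F'}`, `F' ⊇ collarBlock n`, whose
exterior is at sup-distance `≥ (2n+2)b + 1` from the centre cell (`≤ 64 b⁴` edges). -/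
theorem not_wildWireAt_of_weakMixing {N : ℕ} {ρ : G →* Matrix (Fin N) (Fin N) ℂ} {β C ℓ : ℝ} {b n : ℕ}
    (hM : WeakMixing ρ β C ℓ) (hb : 1 ≤ b)
    (h : C * (64 * (b : ℝ) ^ 4) * Real.exp (-((2 * (n : ℝ) + 2) * b + 1) / ℓ) < 1 / 3) :
    ¬ WildWireAt ρ β b n := by
  rintro ⟨w, hw, A, F', ζ₀, ζ₁, hA, hAdep, hF', h0, h1⟩
  -- the test function `1_A`
  have hf_meas : Measurable (A.indicator (1 : LGConfig 4 G → ℝ)) := measurable_one.indicator hA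
  have hf_cyl : IsCylinder (A.indicator (1 : LGConfig 4 G → ℝ)) (cellEdges w 0) := by
    intro σ σ' hagree
    have hσσ' : (σ ∈ A) = (σ' ∈ A) := hAdep hagree
    by_cases hσ : σ ∈ A
    · have hσ' : σ' ∈ A := hσσ' ▸ hσ
      rw [Set.indicator_of_mem hσ, Set.indicator_of_mem hσ', Pi.one_apply, Pi.one_apply]
    · have hσ' : σ' ∉ A := fun h' => hσ (hσσ' ▸ h')
      rw [Set.indicator_of_notMem hσ, Set.indicator_of_notMem hσ']
  have hf01 : ∀ U : LGConfig 4 G,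
      0 ≤ A.indicator (1 : LGConfig 4 G → ℝ) U ∧ A.indicator (1 : LGConfig 4 G → ℝ) U ≤ 1 := by
    intro U
    by_cases hU : U ∈ A
    · rw [Set.indicator_of_mem hU, Pi.one_apply]; norm_num
    · rw [Set.indicator_of_notMem hU]; norm_num
  -- geometry: `Δ = cell 0 ⊆ Λ = regionEdges w F'`, exterior at distance `≥ (2n+2) b + 1`
  have hΔΛ : cellEdges w 0 ⊆ regionEdges w F' :=
    cellEdges_zero_subset_regionEdges
      (mem_of_collarBlock_subset hF' 0 fun i => by constructor <;> simp only [Pi.zero_apply] <;> omega)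
  have hdist : ∀ e ∈ cellEdges w 0, ∀ e' : ZdEdge 4, e' ∉ regionEdges w F' →
      (2 * (n : ℝ) + 2) * b + 1 ≤ ‖e.1 - e'.1‖ := by
    intro e he e' he'
    have hd := hw.dist_cellEdges_zero hb (m := 2 * n + 2) (mem_of_collarBlock_subset hF') he he'
    push_cast at hd
    exact hd
  -- weak mixing on `1_A`
  have hWM := hM (regionEdges w F') (cellEdges w 0) _ hΔΛ hdist _ hf_cyl hf_meas hf01 ζ₁ ζ₀
  rw [integral_indicator_one hA, integral_indicator_one hA] at hWM
  -- replace `#Δ` by `64 b⁴`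
  have hbig : |(ymSpecification ρ β (regionEdges w F') ζ₁).real A -
      (ymSpecification ρ β (regionEdges w F') ζ₀).real A| ≤
      C * ((64 * b ^ 4 : ℕ) : ℝ) * Real.exp (-((2 * (n : ℝ) + 2) * b + 1) / ℓ) :=
    weakMixing_bound_mono (hw.one_le_card_cellEdges_zero hb) hw.card_cellEdges_zero_le hWM (abs_nonneg _)
  push_cast at hbig
  have hle := le_abs_self ((ymSpecification ρ β (regionEdges w F') ζ₁).real A -
      (ymSpecification ρ β (regionEdges w F') ζ₀).real A)
  linarith

/-- **Weak mixing forbids the mass wire at `(β, b, n, p)`, `p > 0`,** whenever `64 C b⁴ · exp (−(2nb+1)/ℓ) < 1/3`: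
the torus mass floor makes both polarising classes non-empty, and the window `regionEdges w (windowCells n)` has
its exterior at sup-distance `≥ 2nb + 1` from the centre cell. -/
theorem not_massWireAt_of_weakMixing {N : ℕ} {ρ : G →* Matrix (Fin N) (Fin N) ℂ} {β C ℓ p : ℝ} {b n : ℕ}
    (hM : WeakMixing ρ β C ℓ) (hb : 1 ≤ b) (hp : 0 < p)
    (h : C * (64 * (b : ℝ) ^ 4) * Real.exp (-(2 * (n : ℝ) * b + 1) / ℓ) < 1 / 3) :
    ¬ MassWireAt ρ β b n p := by
  rintro ⟨w, hw, f, S₀, S₁, Sthr, hf, hfm, hf01, hlo, hhi, hmass⟩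
  have hw' : IsFrame b w := hw
  -- both classes are non-empty (torus mass `≥ p > 0` on the torus of side `2 Sthr + 1`)
  obtain ⟨hm0, hm1⟩ := hmass Sthr le_rfl
  have hp' : (0 : ENNReal) < ENNReal.ofReal p := ENNReal.ofReal_pos.2 hp
  obtain ⟨V₀, hV₀⟩ := nonempty_of_measure_ne_zero (lt_of_lt_of_le hp' hm0).ne'
  obtain ⟨V₁, hV₁⟩ := nonempty_of_measure_ne_zero (lt_of_lt_of_le hp' hm1).ne'
  -- geometry
  have hΔΛ : cellEdges w 0 ⊆ regionEdges w (windowCells n) :=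
    cellEdges_zero_subset_regionEdges (zero_mem_windowCells n)
  have hdist : ∀ e ∈ cellEdges w 0, ∀ e' : ZdEdge 4, e' ∉ regionEdges w (windowCells n) →
      2 * (n : ℝ) * b + 1 ≤ ‖e.1 - e'.1‖ := by
    intro e he e' he'
    have hd := hw'.dist_cellEdges_zero hb (m := 2 * n) (fun c hc => mem_windowCells_of_abs_le c hc) he he'
    push_cast at hd
    exact hd
  -- weak mixing on `f`
  have hWM := hM (regionEdges w (windowCells n)) (cellEdges w 0) _ hΔΛ hdist f hf hfm hf01
    (torusLift (2 * Sthr + 1) V₁) (torusLift (2 * Sthr + 1) V₀)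
  have hbig : |(∫ U, f U ∂(ymSpecification ρ β (regionEdges w (windowCells n)) (torusLift (2 * Sthr + 1) V₁))) -
      ∫ U, f U ∂(ymSpecification ρ β (regionEdges w (windowCells n)) (torusLift (2 * Sthr + 1) V₀))| ≤
      C * ((64 * b ^ 4 : ℕ) : ℝ) * Real.exp (-(2 * (n : ℝ) * b + 1) / ℓ) :=
    weakMixing_bound_mono (hw'.one_le_card_cellEdges_zero hb) hw'.card_cellEdges_zero_le hWM (abs_nonneg _)
  push_cast at hbig
  have h0 := hlo _ hV₀
  have h1 := hhi _ hV₁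
  have hle := le_abs_self ((∫ U, f U ∂(ymSpecification ρ β (regionEdges w (windowCells n))
      (torusLift (2 * Sthr + 1) V₁))) -
    ∫ U, f U ∂(ymSpecification ρ β (regionEdges w (windowCells n)) (torusLift (2 * Sthr + 1) V₀)))
  linarith

/-- The rate computation at mesh `1`: if `0 < ℓ` and `192 C ℓ < R` then `C · 64 · 1⁴ · exp (−R/ℓ) < 1/3`. -/
theorem rate_lt_third {C ℓ R : ℝ} (hℓ : 0 < ℓ) (hCR : 192 * C * ℓ < R) :
    C * (64 * ((1 : ℕ) : ℝ) ^ 4) * Real.exp (-R / ℓ) < 1 / 3 := by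
  have hE : 0 < Real.exp (-R / ℓ) := Real.exp_pos _
  simp only [Nat.cast_one, one_pow, mul_one]
  by_cases hC : C ≤ 0
  · have : C * 64 * Real.exp (-R / ℓ) ≤ 0 :=
      mul_nonpos_of_nonpos_of_nonneg (by linarith) hE.le
    linarith
  push Not at hC
  -- `exp (R/ℓ) ≥ 1 + R/ℓ > 192 C`
  have hx : 192 * C < Real.exp (R / ℓ) := by
    have h1 : 192 * C < R / ℓ := by rw [lt_div_iff₀ hℓ]; linarith
    have h2 : R / ℓ + 1 ≤ Real.exp (R / ℓ) := Real.add_one_le_exp _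
    linarith
  rw [neg_div, Real.exp_neg, ← div_eq_mul_inv, div_lt_iff₀ (Real.exp_pos _)]
  linarith

end Kill

/-! ## §4 Frequent weak mixing in `β` kills `WildWire` and `MassWire` -/

section Wires

variable {G : Type} [Group G] [TopologicalSpace G] [IsTopologicalGroup G] [CompactSpace G]
  [MeasurableSpace G] [BorelSpace G] {N : ℕ} {ρ : G →* Matrix (Fin N) (Fin N) ℂ}

/-- **Weak mixing at some scale, for UNBOUNDEDLY MANY `β`, refutes `WildWire ρ`.**  (At a weakly mixing `β ≥ β₀`,
mesh `b = 1` and a window `n` with `2n + 3 > 192 C ℓ` admit no polarisation `≥ 1/3`.) -/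
theorem not_wildWire_of_frequently_hasWeakMixing (h : ∃ᶠ β in atTop, HasWeakMixing ρ β) : ¬ WildWire ρ := by
  rintro ⟨β₀, hW⟩
  obtain ⟨β, ⟨C, ℓ, hℓ, hM⟩, hβ⟩ := (h.and_eventually (eventually_ge_atTop β₀)).exists
  obtain ⟨n, hn⟩ := exists_nat_gt (192 * C * ℓ)
  refine not_wildWireAt_of_weakMixing (b := 1) (n := n + 1) hM le_rfl ?_ (hW β hβ 1 (n + 1) le_rfl (by omega))
  have hCR : 192 * C * ℓ < (2 * ((n + 1 : ℕ) : ℝ) + 2) * ((1 : ℕ) : ℝ) + 1 := by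
    push_cast
    linarith
  exact rate_lt_third hℓ hCR

/-- **Eventual weak mixing refutes `WildWire ρ`** (the owner's shape, R77 §5(ii)). -/
theorem not_wildWire_of_eventually_hasWeakMixing (h : ∀ᶠ β in atTop, HasWeakMixing ρ β) : ¬ WildWire ρ :=
  not_wildWire_of_frequently_hasWeakMixing h.frequently

/-- **`WildWire ρ` says: beyond some `β₀`, NO `β` is weakly mixing at any scale.** -/
theorem wildWire_eventually_not_hasWeakMixing (hW : WildWire ρ) : ∀ᶠ β in atTop, ¬ HasWeakMixing ρ β :=
  Filter.not_frequently.1 fun h => not_wildWire_of_frequently_hasWeakMixing h hW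

/-- **Weak mixing at some scale, for unboundedly many `β`, refutes `MassWire ρ`** (the T-side hypothesis of
p500647): mesh `b = 1`, window `n` with `2n + 3 > 192 C ℓ`. -/
theorem not_massWire_of_frequently_hasWeakMixing (h : ∃ᶠ β in atTop, HasWeakMixing ρ β) : ¬ MassWire ρ := by
  rintro ⟨p, hp, β₀, hW⟩
  obtain ⟨β, ⟨C, ℓ, hℓ, hM⟩, hβ⟩ := (h.and_eventually (eventually_ge_atTop β₀)).exists
  obtain ⟨n, hn⟩ := exists_nat_gt (192 * C * ℓ)
  refine not_massWireAt_of_weakMixing (b := 1) (n := n + 1) hM le_rfl hp ?_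
    (hW β hβ 1 (n + 1) le_rfl (by omega))
  have hCR : 192 * C * ℓ < 2 * ((n + 1 : ℕ) : ℝ) * ((1 : ℕ) : ℝ) + 1 := by
    push_cast
    linarith
  exact rate_lt_third hℓ hCR

/-- **Eventual weak mixing refutes `MassWire ρ`.** -/
theorem not_massWire_of_eventually_hasWeakMixing (h : ∀ᶠ β in atTop, HasWeakMixing ρ β) : ¬ MassWire ρ :=
  not_massWire_of_frequently_hasWeakMixing h.frequently

/-- **`MassWire ρ` says: beyond some `β₀`, NO `β` is weakly mixing at any scale.** -/
theorem massWire_eventually_not_hasWeakMixing (hW : MassWire ρ) : ∀ᶠ β in atTop, ¬ HasWeakMixing ρ β :=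
  Filter.not_frequently.1 fun h => not_massWire_of_frequently_hasWeakMixing h hW

end Wires

end Summit.QuantumFields.YangMills.Cruxes.IR.OnsetFormatsUc

end
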